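import Summits.QuantumFields.YangMills.Theorems.BalabanUVNodesN07QOfRecordFlatOnto
import Summits.QuantumFields.YangMills.Theorems.BalabanUVNodesN12FlatFibreNullSpace
import Literature.MathematicalPhysics.QuantumFieldTheory.Balaban1983to89.B5Eq172HodgePositivity
import Literature.MathematicalPhysics.QuantumFieldTheory.Balaban1983to89.B5Eq172PoincareTorus
import HarnessLib

/-!
# NODE N07 ([15] = [Balaban1985Variational]) — THE FLAT FORM OF def-Y's `Δ_{1,a}(U₀)` OF RECORD (✓p812960 `Node00.BgLettersOfRecord.laplaceAOfRecord`):
# at `U₀ = 1`, for ANY averaging letters `Q`, `Q′`, `re⟪x, Δ_{1,a}(1)x⟫ = ‖D(1)x‖² + ‖R_{Q′}(1)(D(1)*x)‖² + a‖Qx‖²` ([B5] (1.69) at the record), the KERNEL FORM of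
# the displayed `hpos` at `1`, and the Poincaré lemma (Hodge (H1)) on the record's fine torus

Cell `pub-ymgap`, width seat `pub-ymgap-dag-n07-w3` (g24), CLAIM-2.  `--kind proof --supports stmt-QuantumFields-27238 --as helper`; count-neutral.
[15] = [Balaban1985Variational]; [B9] = [Balaban1985BackgroundPropagators]; [B5] = [Balaban1984PropagatorsI].

WHY.  def-Y's M1 file 3a pins (110)'s `Δ_{1,a}(U₀) = Δ₁ + D R D* + Q*(aQ)` at the record (`laplaceAOfRecord F N k U₀ Q Q′ a` = lit's `laplaceALatticeK` at the
record's fibre `WRec N`, transporters `RRec`∕`SRec`, Hessian `hessOpOfRecord`, restriction `RrOfRecord … Q′`) and leaves the positivity `hpos` ([B9] Thm 3.11 at the record)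
DISPLAYED.  This file writes what `hpos` IS at the flat background, for every `Q`, `Q′`: by lit's (1.69)∕Hodge lemmas (✓`B5Eq172HodgePositivity.re_inner_laplaceAK_projR`,
✓`laplaceALatticeK_RLatticeK_eq`, ✓`re_inner_principalOpK_one`, ✓`B5Eq172PoincareTorus.hodge_flat`) read at the record's letters, once the record's transporters and Hessian at
`U₀ = 1` are identified with lit's flat letters (§1).  Sequel roads (bus 2026-08-31, dag-lead WORDS 676 ∕ this seat's LOCATED note): with `Q := QOfRecord F N k 1` the zero-mode
statement of §3 is (i) a Plancherel∕alias-sum lemma for the pinned site letter `Q′ := QprimeOfRecord F N k 1` (size L), or (ii) lit's ✓`laplaceALatticeK_pos_of_hodge` for a site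
letter satisfying [B5] (1.55) `Q∘D = ∂₁∘Q′` — neither is in this file.

WHAT IS PROVED (sorry-free; no definition; axioms standard).
* §1 flat letters of record: `unitsOfRecord_one` (`unitsOfRecord F N 1 = 1`), `RRec_one` ∕ `SRec_one` (`R(1) = R(1)⁻¹ = id` on the fibre), ★ `hessOpOfRecord_one`
  (`Δ₁(1) = D*D`: lit ✓`hessOp_one`, the curvature part vanishes at the flat background).
* §2 ★★ `re_inner_laplaceAOfRecord_one` — THREE SQUARES: `re⟪x, Δ_{1,a}(1)x⟫ = ‖D(1)x‖² + ‖R_{Q′}(1)(D(1)*x)‖² + a·‖Qx‖²` for every `Q`, `Q′`, `a`;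
  `re_inner_laplaceAOfRecord_one_nonneg` (`a ≥ 0`).
* §3 ★★ `laplaceAOfRecord_one_pos_iff` — KERNEL FORM of `hpos` at `1` (`a > 0`):
  `(∀ x ≠ 0, 0 < re⟪x, Δ_{1,a}(1)x⟫) ↔ (∀ x, D(1)x = 0 ∧curl → R_{Q′}(1)(D(1)*x) = 0 → Qx = 0 → x = 0)` — the three terms vanish separately ([B5] (1.72)).
* §4 ★ `exists_covDeriv_add_const_of_covCurl_one` — (H1) AT THE RECORD's FINE TORUS: a `D(1)`-curl-free `x` is `D(1)l + (constant vector function)`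
  (lit's Poincaré lemma ✓`hodge_flat`, generic in the torus, at `Bond (F.P K).d (fun _ => (F.P K).sitesPerDir 0)`, flat transporters `RRec F N 1`).
* §5 (H3) FOR THE PINNED BOND AVERAGING `Q := QOfRecord F N k 1` (✓p814239): `qSkewOp_one_dirConst` ∕ `qCplxOp_one_dirConst` (a direction-constant matrix field
  `b ↦ M_{dir b}` is reproduced at level `k`: dag-n12's ✓`N12FlatFibreNullSpace.iterLin_dirConst` `Q^{(k)}A₀ = L^k·A₀` + n07-w1's ✓`dIterL_one_apply_of_skew` + this
  seat's ✓`qSkewOp_one_apply`, complexified by `skewField_decomp`), ★ `QOfRecord_one_constBond` («Q_kA₀ = A₀» [B5] (1.57) for the record's `Q(1)`: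
  the constant vector function `v` ↦ the coarse constant vector function `v`), `eq_zero_of_QOfRecord_one_constBond_eq_zero` (injective on constants).

HONEST SCOPE.  Bookkeeping at `U₀ = 1` + lit's generic (1.69)∕Poincaré lemmas read at the record's letters; `Q`, `Q′`, `a` stay binders; `hpos` is NOT discharged here (§3 only
re-expresses it); nothing of [B5]∕[B9]∕[15] asserted; P0 OPEN; N07 NOT discharged; K0ᴬ∕K1ᴬ∕K3ᴬ OPEN; counts unmoved (28∕28 · 8∕28 · K 1∕4); one finite 𝕋⁴ programme at fixed ε —
R4 closes the conditional finite-𝕋⁴ rung `BalabanLadder.UV` only, never the summit; nothing continuum ∕ ℝ⁴ ∕ OS; the Yang–Mills mass gap (Clay) is NOT proved by any of this.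
No `sorry`, no `def`, no `instance`, no `notation`.

References: [B9] (3.3) p.391, (3.8) p.392, (3.10) p.392, (3.21)–(3.26) pp.394–395, Thm 3.11 p.416; [B5] (1.69) p.29, (1.72) p.30; [15] (110)–(111) p.294, (116)–(117) p.295.
-/

set_option autoImplicit false

noncomputable section

open scoped InnerProductSpace ComplexConjugate Matrix

namespace Summit.QuantumFields.YangMills.Theorems.N07LaplaceAOfRecordFlatForm

open Literature.MathematicalPhysics.QuantumFieldTheory.Balaban1983to89
open Literature.MathematicalPhysics.QuantumFieldTheory.Balaban1983to89.T4Continuum (T4Family)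
open B4Sect5Torus (TSite)
open B9SectCLatticeCarrier (Bond)
open B9Eq311L2Pairing (WL2)
open B9Eq310HessianOperator (adTransportW principalOpK hessOp hessOp_one covCurlL2K)
open B11Eq103H1Complex (SiteL2K BondL2K covDerivL2K covDivL2K adjoint_covDerivL2K)
open B5Eq172HodgePositivity (re_inner_laplaceAK_projR laplaceALatticeK_RLatticeK_eq re_inner_principalOpK_one adTransportW_one adTransportW_inv_one)
open B5Eq172PoincareTorus (constBond constBondL2K equiv_constBondL2K constBond_apply hodge_flat)
open Node00
open Summit.QuantumFields.YangMills.Theorems.ChartHInv (exists_linFamily)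
open Summit.QuantumFields.YangMills.BalabanUVNodes.N12FlatFibreNullSpace (iterLin_dirConst)
open Summit.QuantumFields.YangMills.Theorems.N07QOfRecordFlatOnto (qSkewOp_one_apply skewField_conjTranspose)

variable (F : T4Family) (N : ℕ) [NeZero N] {K : ℕ} (k : ℕ)

/-! ## §1  The record's letters at the flat background `U₀ = 1` -/

/-- At `U₀ = 1` the units-valued transporter datum of record is the constant `1`. [cite: Balaban1985BackgroundPropagators, (3.1) p.390 (bookkeeping)] -/
theorem unitsOfRecord_one : unitsOfRecord F N (K := K) (1 : GaugeField (F.P K) 0 (SU N)) = fun _ => 1 := by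
  funext a
  ext
  rw [coe_unitsOfRecord, Units.val_one]
  rfl

/-- At `U₀ = 1` the transporter `R(U₀(b))` on the Hilbert fibre is the identity. [cite: Balaban1985BackgroundPropagators, p.390, p.395] -/
theorem RRec_one (a : Bond (F.P K).d (fun _ => (F.P K).sitesPerDir 0)) : RRec F N (1 : GaugeField (F.P K) 0 (SU N)) a = LinearMap.id := by
  unfold RRec
  rw [unitsOfRecord_one]
  exact adTransportW_one (phiRec N) a

/-- At `U₀ = 1` the adjoint transporter `R(U₀(b)⁻¹)` is the identity. [cite: Balaban1985BackgroundPropagators, (3.8) p.392, p.395] -/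
theorem SRec_one (a : Bond (F.P K).d (fun _ => (F.P K).sitesPerDir 0)) : SRec F N (1 : GaugeField (F.P K) 0 (SU N)) a = LinearMap.id := by
  unfold SRec
  rw [unitsOfRecord_one]
  exact adTransportW_inv_one (phiRec N) a

/-- ★ **`Δ₁(1) = D*D` AT THE RECORD**: the Hessian of record at the flat background is its principal part at lit's flat letters (the curvature part `Δ′(1)` vanishes,
lit ✓`hessOp_one`). [cite: Balaban1985BackgroundPropagators, (3.10) p.392] -/
theorem hessOpOfRecord_one [Fact (0 < c0Rec F K k)] :
    hessOpOfRecord F N k (1 : GaugeField (F.P K) 0 (SU N)) =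
      principalOpK (c₀ := c0Rec F K k) (phiRec N) ((F.P K).eta k)
        (fun _ : Bond (F.P K).d (fun _ => (F.P K).sitesPerDir 0) => (1 : (Matrix (Fin N) (Fin N) ℂ)ˣ)) := by
  unfold hessOpOfRecord
  rw [unitsOfRecord_one, hessOp_one]

/-! ## §2  [B5] (1.69) at the record, flat: three squares -/

section Form

variable {β : Type*} [Fintype β] {wB : β → ℝ} [Fact (∀ y, 0 < wB y)] {F' : Type*} [AddCommGroup F'] [Module ℂ F']

/-- ★★ **THREE SQUARES** — for EVERY bond-averaging letter `Q`, site-averaging letter `Q′` and `a`: at `U₀ = 1`,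
`re⟪x, Δ_{1,a}(1)x⟫ = ‖D(1)x‖² + ‖R_{Q′}(1)(D(1)*x)‖² + a·‖Qx‖²`, where `D(1)` is the flat curl `covCurlL2K … (RRec F N 1)` (principal part `D*D`, §1),
`D(1)* = covDivL2K … (SRec F N 1)` the flat divergence ((3.8) = the Hilbert adjoint) and `R_{Q′}(1) = RrOfRecord F N k 1 Q′` the orthogonal projection onto `Δ(1) N(Q′)` ((3.21)).
[cite: Balaban1984PropagatorsI, (1.69) p.29; Balaban1985BackgroundPropagators, (3.21)-(3.26) pp.394-395; Balaban1985Variational, (110) p.294] -/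
theorem re_inner_laplaceAOfRecord_one [Fact (0 < c0Rec F K k)]
    (Q : BondL2K ℂ (F.P K).d (fun _ => (F.P K).sitesPerDir 0) (c0Rec F K k) (WRec N) →ₗ[ℂ] WL2 ℂ wB (WRec N))
    (Q' : SiteL2K ℂ (F.P K).d (fun _ => (F.P K).sitesPerDir 0) (c0Rec F K k) (WRec N) →ₗ[ℂ] F') (a : ℝ)
    (x : BondL2K ℂ (F.P K).d (fun _ => (F.P K).sitesPerDir 0) (c0Rec F K k) (WRec N)) :
    RCLike.re ⟪x, laplaceAOfRecord F N k (1 : GaugeField (F.P K) 0 (SU N)) Q Q' a x⟫_ℂ =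
      ‖covCurlL2K ℂ (c0Rec F K k) (cRec F K k) (RRec F N (1 : GaugeField (F.P K) 0 (SU N))) x‖ ^ 2 +
        ‖RrOfRecord F N k (1 : GaugeField (F.P K) 0 (SU N)) Q'
            (covDivL2K ℂ (c0Rec F K k) (cRec F K k) (SRec F N (1 : GaugeField (F.P K) 0 (SU N))) x)‖ ^ 2 +
          a * ‖Q x‖ ^ 2 := by
  have hc := conj_cRec F K k
  have hRS := inner_RRec_left (F := F) (N := N) (K := K) (1 : GaugeField (F.P K) 0 (SU N))
  have hΔ : RCLike.re ⟪x, hessOpOfRecord F N k (1 : GaugeField (F.P K) 0 (SU N)) x⟫_ℂ =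
      ‖covCurlL2K ℂ (c0Rec F K k) (cRec F K k) (RRec F N (1 : GaugeField (F.P K) 0 (SU N))) x‖ ^ 2 := by
    have hR : RRec F N (1 : GaugeField (F.P K) 0 (SU N)) =
        adTransportW (phiRec N) (fun _ : Bond (F.P K).d (fun _ => (F.P K).sitesPerDir 0) => (1 : (Matrix (Fin N) (Fin N) ℂ)ˣ)) := by
      unfold RRec
      rw [unitsOfRecord_one]
    rw [hessOpOfRecord_one, hR, cRec]
    exact re_inner_principalOpK_one (phiRec N) ((F.P K).eta k) x
  unfold laplaceAOfRecord RrOfRecord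
  rw [laplaceALatticeK_RLatticeK_eq _ hc _ _ hRS, re_inner_laplaceAK_projR, hΔ, adjoint_covDerivL2K _ hc _ _ hRS]
  rfl

/-- Nonnegativity of the flat form for `a ≥ 0` («non-negative as a sum of … non-negative operators»). [cite: Balaban1984PropagatorsI, p.30] -/
theorem re_inner_laplaceAOfRecord_one_nonneg [Fact (0 < c0Rec F K k)]
    (Q : BondL2K ℂ (F.P K).d (fun _ => (F.P K).sitesPerDir 0) (c0Rec F K k) (WRec N) →ₗ[ℂ] WL2 ℂ wB (WRec N))
    (Q' : SiteL2K ℂ (F.P K).d (fun _ => (F.P K).sitesPerDir 0) (c0Rec F K k) (WRec N) →ₗ[ℂ] F') {a : ℝ} (ha : 0 ≤ a)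
    (x : BondL2K ℂ (F.P K).d (fun _ => (F.P K).sitesPerDir 0) (c0Rec F K k) (WRec N)) :
    0 ≤ RCLike.re ⟪x, laplaceAOfRecord F N k (1 : GaugeField (F.P K) 0 (SU N)) Q Q' a x⟫_ℂ := by
  rw [re_inner_laplaceAOfRecord_one]
  positivity

/-! ## §3  The kernel form of `hpos` at the flat background -/

/-- ★★ **KERNEL FORM OF THE DISPLAYED `hpos` AT `U₀ = 1`** (`a > 0`): positivity of `Δ_{1,a}(1)` on `x ≠ 0` is EQUIVALENT to the zero-mode statement «`D(1)x = 0`,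
`R_{Q′}(1)(D(1)*x) = 0` and `Qx = 0` force `x = 0`» — the three squares of §2 vanish separately ([B5] (1.72) «ΔA − ∂P∂*A = 0, QA = 0 … so A = 0»).
[cite: Balaban1984PropagatorsI, (1.72) p.30; Balaban1985BackgroundPropagators, Thm 3.11 p.416; Balaban1985Variational, (116)-(117) p.295] -/
theorem laplaceAOfRecord_one_pos_iff [Fact (0 < c0Rec F K k)]
    (Q : BondL2K ℂ (F.P K).d (fun _ => (F.P K).sitesPerDir 0) (c0Rec F K k) (WRec N) →ₗ[ℂ] WL2 ℂ wB (WRec N))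
    (Q' : SiteL2K ℂ (F.P K).d (fun _ => (F.P K).sitesPerDir 0) (c0Rec F K k) (WRec N) →ₗ[ℂ] F') {a : ℝ} (ha : 0 < a) :
    (∀ x, x ≠ 0 → 0 < RCLike.re ⟪x, laplaceAOfRecord F N k (1 : GaugeField (F.P K) 0 (SU N)) Q Q' a x⟫_ℂ) ↔
      ∀ x : BondL2K ℂ (F.P K).d (fun _ => (F.P K).sitesPerDir 0) (c0Rec F K k) (WRec N),
        covCurlL2K ℂ (c0Rec F K k) (cRec F K k) (RRec F N (1 : GaugeField (F.P K) 0 (SU N))) x = 0 →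
        RrOfRecord F N k (1 : GaugeField (F.P K) 0 (SU N)) Q'
            (covDivL2K ℂ (c0Rec F K k) (cRec F K k) (SRec F N (1 : GaugeField (F.P K) 0 (SU N))) x) = 0 →
        Q x = 0 → x = 0 := by
  constructor
  · intro hpos x h1 h2 h3
    by_contra hx
    have h := hpos x hx
    rw [re_inner_laplaceAOfRecord_one, h1, h2, h3] at h
    norm_num at h
  · intro hker x hx
    have hnn := re_inner_laplaceAOfRecord_one_nonneg F N k Q Q' ha.le x
    rcases hnn.lt_or_eq with hlt | heq
    · exact hlt
    · exfalso
      apply hx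
      rw [re_inner_laplaceAOfRecord_one] at heq
      have h1 : ‖covCurlL2K ℂ (c0Rec F K k) (cRec F K k) (RRec F N (1 : GaugeField (F.P K) 0 (SU N))) x‖ ^ 2 = 0 := by
        nlinarith [sq_nonneg ‖covCurlL2K ℂ (c0Rec F K k) (cRec F K k) (RRec F N (1 : GaugeField (F.P K) 0 (SU N))) x‖,
          sq_nonneg ‖RrOfRecord F N k (1 : GaugeField (F.P K) 0 (SU N)) Q'
            (covDivL2K ℂ (c0Rec F K k) (cRec F K k) (SRec F N (1 : GaugeField (F.P K) 0 (SU N))) x)‖,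
          mul_nonneg ha.le (sq_nonneg ‖Q x‖)]
      have h2 : ‖RrOfRecord F N k (1 : GaugeField (F.P K) 0 (SU N)) Q'
            (covDivL2K ℂ (c0Rec F K k) (cRec F K k) (SRec F N (1 : GaugeField (F.P K) 0 (SU N))) x)‖ ^ 2 = 0 := by
        nlinarith [sq_nonneg ‖covCurlL2K ℂ (c0Rec F K k) (cRec F K k) (RRec F N (1 : GaugeField (F.P K) 0 (SU N))) x‖,
          sq_nonneg ‖RrOfRecord F N k (1 : GaugeField (F.P K) 0 (SU N)) Q'
            (covDivL2K ℂ (c0Rec F K k) (cRec F K k) (SRec F N (1 : GaugeField (F.P K) 0 (SU N))) x)‖,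
          mul_nonneg ha.le (sq_nonneg ‖Q x‖)]
      have h3 : a * ‖Q x‖ ^ 2 = 0 := by
        nlinarith [sq_nonneg ‖covCurlL2K ℂ (c0Rec F K k) (cRec F K k) (RRec F N (1 : GaugeField (F.P K) 0 (SU N))) x‖,
          sq_nonneg ‖RrOfRecord F N k (1 : GaugeField (F.P K) 0 (SU N)) Q'
            (covDivL2K ℂ (c0Rec F K k) (cRec F K k) (SRec F N (1 : GaugeField (F.P K) 0 (SU N))) x)‖,
          mul_nonneg ha.le (sq_nonneg ‖Q x‖)]
      have e1 := norm_eq_zero.1 (pow_eq_zero_iff two_ne_zero |>.1 h1)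
      have e2 := norm_eq_zero.1 (pow_eq_zero_iff two_ne_zero |>.1 h2)
      have e3 : Q x = 0 := by
        have : ‖Q x‖ ^ 2 = 0 := by
          rcases mul_eq_zero.1 h3 with h | h
          · exact absurd h ha.ne'
          · exact h
        exact norm_eq_zero.1 (pow_eq_zero_iff two_ne_zero |>.1 this)
      exact hker x e1 e2 e3

end Form

/-! ## §4  (H1) at the record's fine torus: the Poincaré lemma at the flat background -/

/-- ★ **(H1) AT THE RECORD: a `D(1)`-curl-free bond function on the record's fine torus is a flat gradient plus a constant vector function** — lit's Poincaré lemma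
✓`B5Eq172PoincareTorus.hodge_flat` (generic in the torus) at the carrier `Bond (F.P K).d (fun _ => (F.P K).sitesPerDir 0)`, scalar `cRec F K k = η_k⁻¹ ≠ 0`, transporters
`RRec F N 1 = id` (§1). [cite: Balaban1984PropagatorsI, (1.72) p.30; Balaban1985BackgroundPropagators, (3.3) p.391] -/
theorem exists_covDeriv_add_const_of_covCurl_one [Fact (0 < c0Rec F K k)]
    (x : BondL2K ℂ (F.P K).d (fun _ => (F.P K).sitesPerDir 0) (c0Rec F K k) (WRec N))
    (hx : covCurlL2K ℂ (c0Rec F K k) (cRec F K k) (RRec F N (1 : GaugeField (F.P K) 0 (SU N))) x = 0) :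
    ∃ l : SiteL2K ℂ (F.P K).d (fun _ => (F.P K).sitesPerDir 0) (c0Rec F K k) (WRec N),
      ∃ h ∈ LinearMap.range (constBondL2K (fun _ : Fin (F.P K).d => (F.P K).sitesPerDir 0) ℂ (c0Rec F K k)),
        x = covDerivL2K ℂ (c0Rec F K k) (cRec F K k) (RRec F N (1 : GaugeField (F.P K) 0 (SU N))) l + h := by
  have hc : cRec F K k ≠ 0 := by
    rw [cRec]
    exact inv_ne_zero (Complex.ofReal_ne_zero.2 (factEta F K k).out.ne')
  exact hodge_flat (𝕜 := ℂ) hc (RRec_one F N) x hx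

/-! ## §5  (H3) for the pinned bond averaging `Q := QOfRecord F N k 1`: constant vector functions are reproduced -/

/-- On a direction-constant SKEW matrix field `b ↦ S_{dir b}` def-Y's real-form operator at the flat background is the level change: `qSkewOp k 1 (b ↦ S_{dir b}) c = S_{dir c}`
(`qSkewOp k 1 = L^{-k}·Q_k(1)`, `Q_k(1) = Q^{(k)}` on skew fields, `Q^{(k)}A₀ = L^k·A₀`). [cite: Balaban1984PropagatorsI, (1.57) p.27; Balaban1985Variational, (44) p.285] -/
theorem qSkewOp_one_dirConst {S : Fin (F.P K).d → Matrix (Fin N) (Fin N) ℂ} (hS : ∀ μ, (S μ)ᴴ = -S μ) (c : PBond (F.P K) k) :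
    qSkewOp k (1 : GaugeField (F.P K) 0 (SU N)) (fun b : PBond (F.P K) 0 => S b.dir) c = S c.dir := by
  obtain ⟨Q, hQ0, hQs⟩ := exists_linFamily (P := F.P K) (n := Fin N)
  have hYs : ∀ b : PBond (F.P K) 0, star ((fun b : PBond (F.P K) 0 => S b.dir) b) = -(fun b : PBond (F.P K) 0 => S b.dir) b := fun b => by
    rw [Matrix.star_eq_conjTranspose]
    exact hS b.dir
  have hL : ((F.P K).L : ℂ) ^ k ≠ 0 := pow_ne_zero _ (Nat.cast_ne_zero.mpr (F.P K).L_pos.ne')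
  rw [qSkewOp_one_apply, (dIterL_one_apply_of_skew Q hQ0 hQs hYs k).1, iterLin_dirConst Q hQ0 hQs S k c, ← Nat.cast_smul_eq_nsmul ℂ, smul_smul,
    Nat.cast_pow, inv_mul_cancel₀ hL, one_smul]

/-- On ANY direction-constant matrix field print's `Q_k(1)` on `𝔤ᶜ`-valued fields (def-Y's `qCplxOp k 1`) is the level change — the real-form statement complexified through
`M = 𝔞M + i·𝔞(−iM)` (`skewField_decomp`). [cite: Balaban1984PropagatorsI, (1.57) p.27; Balaban1985BackgroundPropagators, (3.13) p.393] -/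
theorem qCplxOp_one_dirConst (M : Fin (F.P K).d → Matrix (Fin N) (Fin N) ℂ) :
    qCplxOp k (1 : GaugeField (F.P K) 0 (SU N)) (fun b : PBond (F.P K) 0 => M b.dir) = fun c : PBond (F.P K) k => M c.dir := by
  funext c
  have e1 : skewField (fun b : PBond (F.P K) 0 => M b.dir) = fun b : PBond (F.P K) 0 => skewField M b.dir := rfl
  have e2 : skewField (-Complex.I • fun b : PBond (F.P K) 0 => M b.dir) = fun b : PBond (F.P K) 0 => skewField (-Complex.I • M) b.dir := rfl
  unfold qCplxOp
  rw [cplxOp_apply, e1, e2, Pi.add_apply, Pi.smul_apply, qSkewOp_one_dirConst F N k (skewField_conjTranspose M) c,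
    qSkewOp_one_dirConst F N k (skewField_conjTranspose (-Complex.I • M)) c]
  have h := congrFun (skewField_decomp M) c.dir
  rwa [Pi.add_apply, Pi.smul_apply] at h

/-- ★ **«Q_kA₀ = A₀» FOR THE RECORD's `Q(1)`** ((H3) of lit's Hodge package at the pinned letter): the constant vector function with direction values `v` is mapped by
`QOfRecord F N k 1` to the coarse constant vector function with the same values (read in def-Y's slot type over the record's level-`k` bonds).
[cite: Balaban1984PropagatorsI, (1.57) p.27, (1.72) p.30; Balaban1985BackgroundPropagators, (3.13)-(3.16) p.393] -/
theorem QOfRecord_one_constBond (v : Fin (F.P K).d → WRec N) :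
    QOfRecord F N k (1 : GaugeField (F.P K) 0 (SU N)) (constBondL2K (fun _ : Fin (F.P K).d => (F.P K).sitesPerDir 0) ℂ (c0Rec F K k) v) =
      (WL2.equiv ℂ (wBRec F K k) (WRec N)).symm fun c : PBond (F.P K) k => v c.dir := by
  apply (WL2.equiv ℂ (wBRec F K k) (WRec N)).injective
  funext c
  have hin : bondFieldIn F N k (constBondL2K (fun _ : Fin (F.P K).d => (F.P K).sitesPerDir 0) ℂ (c0Rec F K k) v) =
      fun b : PBond (F.P K) 0 => (fun μ => phiRec N (v μ)) b.dir := by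
    funext b
    rw [bondFieldIn_apply, equiv_constBondL2K, constBond_apply]
    rfl
  rw [QOfRecord_apply, Equiv.apply_symm_apply, hin, qCplxOp_one_dirConst F N k (fun μ => phiRec N (v μ))]
  exact (phiRec N).symm_apply_apply _

/-- … injectively: if the image vanishes then `v = 0` (every direction carries a level-`k` bond). [cite: Balaban1984PropagatorsI, (1.72) p.30 («A₀ = 0»)] -/
theorem eq_zero_of_QOfRecord_one_constBond_eq_zero {v : Fin (F.P K).d → WRec N}
    (h : QOfRecord F N k (1 : GaugeField (F.P K) 0 (SU N)) (constBondL2K (fun _ : Fin (F.P K).d => (F.P K).sitesPerDir 0) ℂ (c0Rec F K k) v) = 0) :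
    v = 0 := by
  funext μ
  rw [QOfRecord_one_constBond] at h
  have hc := congrFun (congrArg (WL2.equiv ℂ (wBRec F K k) (WRec N)) h) ⟨default, μ⟩
  rw [Equiv.apply_symm_apply, WL2.equiv_zero] at hc
  exact hc

end Summit.QuantumFields.YangMills.Theorems.N07LaplaceAOfRecordFlatForm

end
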